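import Literature.MathematicalPhysics.QuantumFieldTheory.LatticeYangMillsClusteringTransfer
import Summits.Ventures.YMGap.Thresholds.SharpWindow
import Summits.Ventures.YMGap.StrongCouplingGapShape

/-!
# Venture YMGap — Theorem C, consequence II: exponential clustering of every infinite-volume
# limit for `|β| < 1/(8d)`, conditionally on Shen–Zhu–Zhu's mass-gap step

HONEST FRAMING: venture file (cell `pub-ymgap`, track (a), item A2, mass-gap leg). KERNEL-CHECKED
here: (i) Shen–Zhu–Zhu's Corollary 4.11 AS PRINTED (clustering of every tight limit of the `SU(N)`
torus Wilson states for `|β| < 1/(16(d-1))`, `Literature…shenZhuZhu_massGap_tightLimits`) HOLDS in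
the tree unconditionally (`szz_exponentialClustering`: the tree's Dobrushin-route theorem
`shen_zhu_zhu_holds` + "tight limits are DLR"); (ii) the Hessian hypothesis of the transfer facts
holds with `Λ₀ = 4d` (`SharpWindow.wilsonHessianBound_four_d`, Theorem C) and with no `Λ₀ < 4d`
(`transfer_window_subset_sharp`); (iii) threshold arithmetic. CONDITIONAL (on the NAMED printed fact
`shenZhuZhu_massGap_transfer d N` = SZZ Theorem 4.2 → Cor. 4.4 → Lemma 4.10 → Cor. 4.11 with the
Hessian constant of Lemma 4.1 as a parameter; NOT proved in the tree): `sharp_exponentialClustering`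
— for `d ≥ 2`, `N ≥ 2` and 't Hooft coupling `|β| < 1/(8d)`, EVERY infinite-volume limit point of
the torus `SU(N)` Wilson states at tree coupling `Nβ` has exponentially decaying covariances of
Lipschitz cylinder functions with disjoint supports, in SZZ's form
`|Cov_μ(F₁,F₂)| ≤ c₁ e^{-c d(Λ₁,Λ₂)} (K₁K₂ + ‖F₁‖₂‖F₂‖₂)`; window `1/(8d)` vs printed `1/(16(d-1))`
(`d = 4`: `1/32` vs `1/48`; `SU(2)`: `β_W < 1/8` vs `1/12`; `SU(3)`: `9/32` vs `3/16`), N-uniform.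
NOT here and NOT claimed: DLR uniqueness / `MassGapAt` at `|β| < 1/(8d)` (SZZ's §5 uniqueness proof
uses a per-edge constant, not the global Hessian bound; the cell's Lemma A.1 is class A, not a
Literature fact), area law, anything at physical couplings. The last section makes the gap to the
cell's target type exact and kernel-checked: uniqueness + clustering of tight limits ⇒ `MassGapAt`
(`massGapAt_of_hasUniqueGibbsMeasure`), so `ImprovedThreshold d N (1/(8d))` holds conditionally on
the transfer fact AND the cell's own uniqueness claim `SharpUniqueness` (hypothesis shape, class A)
— `improvedThreshold_sharp_of_uniqueness`. For `SU(2)`, `SU(3)` in `d = 4` the tree's Dobrushin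
fronts are higher; the content of this window is N-uniformity and the FI currency (`SharpWindow`).

Reference: cell files `p2/HESSIAN-SHARP.md` §4, `paper/gap-below-beta0prime.md` Thm A (A3); H. Shen,
R. Zhu, X. Zhu, CMP 400 (2023) 805, Lemma 4.1, Theorem 4.2, Lemma 4.10, Cor. 4.11, Remark 4.12.
-/

noncomputable section

namespace Summit.Ventures.YMGap.HessianSharp

open Literature.MathematicalPhysics.QuantumFieldTheory
open Literature.MathematicalPhysics.QuantumLattice

variable {d N : ℕ}

/-! ## The printed corollary holds in the tree (no hypothesis) -/

/-- **SZZ Corollary 4.11 as printed, unconditionally**: for `d ≥ 2`, `N ≥ 2` and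
`|β| < 1/(16(d-1))`, every infinite-volume limit point of the torus `SU(N)` Wilson states at
coupling `Nβ` clusters exponentially (SZZ form). Proof: the tree's `shen_zhu_zhu_holds`
(Dobrushin route) and "tight limits are DLR states". -/
theorem szz_exponentialClustering (hd : 2 ≤ d) (hN : 2 ≤ N) {β : ℝ}
    (hβ : |β| < szzThresholdSU d) : SZZExponentialClustering d N β :=
  shenZhuZhu_massGap_tightLimits_holds hd hN β hβ

/-- Consistency: the transfer fact fed with the kernel-checked Hessian bound (`8(d-1)`, from `4d`)
returns exactly the printed Corollary 4.11. -/
theorem shenZhuZhu_massGap_tightLimits_of_transfer_kernel (h : shenZhuZhu_massGap_transfer d N)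
    (hd : 2 ≤ d) : shenZhuZhu_massGap_tightLimits d N :=
  shenZhuZhu_massGap_tightLimits_of_transfer h (wilsonHessianBound_szz hd)

/-! ## The sharp clustering window -/

/-- **Exponential clustering for `|β| < 1/(8d)`, conditional on the mass-gap transfer step.**
Assume the named fact `shenZhuZhu_massGap_transfer d N` (SZZ Thm 4.2 → Cor. 4.4 → Lemma 4.10 →
Cor. 4.11 with the Hessian constant as a parameter). Then for `d ≥ 2`, `N ≥ 2` and `|β| < 1/(8d)`,
every infinite-volume limit point `μ` of the torus `SU(N)` Wilson states at coupling `Nβ` satisfies: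
there is `c > 0` and for every `n` a `c₁` with
`|Cov_μ(F₁,F₂)| ≤ c₁ e^{-c d(Λ₁,Λ₂)} (K₁K₂ + ‖F₁‖_{L²(μ)}‖F₂‖_{L²(μ)})` for Lipschitz cylinder
functions with disjoint supports of size `≤ n`. The Hessian input is the kernel theorem
`wilsonHessianBound_four_d` (constant `K = N/2 - 4dN|β| > 0`). -/
theorem sharp_exponentialClustering (h : shenZhuZhu_massGap_transfer d N) (hd : 2 ≤ d)
    (hN : 2 ≤ N) {β : ℝ} (hβ : |β| < sharpThresholdSU d) : SZZExponentialClustering d N β := by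
  have hK : 0 < (N : ℝ) / 2 - N * |β| * (4 * d) := by
    rw [← sharpBakryEmeryConstSU_eq]
    exact (sharpBakryEmeryConstSU_pos_iff (le_trans one_le_two hd) (le_trans one_le_two hN) β).2 hβ
  have hΛ : (0 : ℝ) ≤ 4 * d := by positivity
  exact h (4 * d) hΛ (wilsonHessianBound_four_d d N) hd hN β hK

/-- **The sharp window, both currencies.** Conditional on the two transfer facts (functional
inequalities: `shenZhuZhu_bakryEmery_transfer`; clustering: `shenZhuZhu_massGap_transfer`), for
`d ≥ 2`, `N ≥ 2`, `|β| < 1/(8d)`: every infinite-volume limit point satisfies SZZ's log-Sobolev and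
Poincaré inequalities with `K = N/2 - 4dN|β|` AND clusters exponentially. -/
theorem sharp_window (h₁ : shenZhuZhu_bakryEmery_transfer d N) (h₂ : shenZhuZhu_massGap_transfer d N)
    (hd : 2 ≤ d) (hN : 2 ≤ N) {β : ℝ} (hβ : |β| < sharpThresholdSU d) :
    SZZFunctionalInequalitiesWith d N β (sharpBakryEmeryConstSU N d β) ∧
      SZZExponentialClustering d N β :=
  ⟨sharp_functionalInequalities h₁ hd (le_trans one_le_two hN) hβ,
    sharp_exponentialClustering h₂ hd hN hβ⟩

/-! ## Packaging as a threshold statement and comparison with the printed window -/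

/-- **Exponential clustering below a threshold**: `SZZExponentialClustering d N β` (every tight
limit of the torus states clusters, SZZ form) for every 't Hooft coupling `|β| < β₀` — the
clustering half of the cell's `MassGapBelow`, for tight limits. -/
def ClusteringBelow (d N : ℕ) (β₀ : ℝ) : Prop :=
  ∀ β : ℝ, |β| < β₀ → SZZExponentialClustering d N β

/-- `ClusteringBelow` is antitone in the threshold. -/
theorem clusteringBelow_mono {β₀ β₁ : ℝ} (hle : β₀ ≤ β₁) (h : ClusteringBelow d N β₁) :
    ClusteringBelow d N β₀ :=
  fun β hβ => h β (hβ.trans_le hle)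

/-- The printed window, unconditionally: `ClusteringBelow d N (1/(16(d-1)))` for `d, N ≥ 2`. -/
theorem clusteringBelow_szz (hd : 2 ≤ d) (hN : 2 ≤ N) : ClusteringBelow d N (szzThresholdSU d) :=
  fun _ hβ => szz_exponentialClustering hd hN hβ

/-- The sharp window, conditionally on the transfer fact: `ClusteringBelow d N (1/(8d))`. -/
theorem clusteringBelow_sharp (h : shenZhuZhu_massGap_transfer d N) (hd : 2 ≤ d) (hN : 2 ≤ N) :
    ClusteringBelow d N (sharpThresholdSU d) :=
  fun _ hβ => sharp_exponentialClustering h hd hN hβ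

/-- **Strictly improved clustering threshold for `d ≥ 3`** (conditional on the transfer fact):
`1/(16(d-1)) < 1/(8d)` and clustering of every tight limit holds below `1/(8d)`; the printed window
is contained in it. -/
theorem improved_clusteringThreshold (h : shenZhuZhu_massGap_transfer d N) (hd : 3 ≤ d)
    (hN : 2 ≤ N) :
    szzThresholdSU d < sharpThresholdSU d ∧ ClusteringBelow d N (sharpThresholdSU d) :=
  ⟨szzThresholdSU_lt_sharpThresholdSU hd, clusteringBelow_sharp h (le_trans (by norm_num) hd) hN⟩

/-- **Relation to the cell's target type.** `MassGapAt d N β` (DLR uniqueness + clustering of every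
DLR state; `StrongCouplingGapShape`) implies `SZZExponentialClustering d N β`, since tight limits
are DLR states: the conditional theorem above delivers exactly the clustering half of `MassGapAt`,
restricted to tight limits, and NOT the uniqueness half. -/
theorem exponentialClustering_of_massGapAt {β : ℝ} (h : MassGapAt d N β) :
    SZZExponentialClustering d N β := by
  intro μ hμ
  haveI : SecondCountableTopology (Matrix (Fin N) (Fin N) ℂ) :=
    inferInstanceAs (SecondCountableTopology (Fin N → Fin N → ℂ))
  haveI : SecondCountableTopology (Matrix.specialUnitaryGroup (Fin N) ℂ) :=
    Topology.IsEmbedding.subtypeVal.secondCountableTopology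
  exact h.2 μ (mem_ymGibbsMeasures_of_mem_infiniteVolumeLimitPoints_holds (fundamentalRep (Fin N))
    (continuous_fundamentalRep (Fin N)) hμ)

/-- Hence `MassGapBelow d N β₀ → ClusteringBelow d N β₀`. -/
theorem clusteringBelow_of_massGapBelow {β₀ : ℝ} (h : MassGapBelow d N β₀) :
    ClusteringBelow d N β₀ :=
  fun β hβ => exponentialClustering_of_massGapAt (h β hβ)

/-- **The reach of the transfer facts is exactly the sharp window.** Any constant `Λ₀` admissible in
the transfer facts (`WilsonHessianBound d N Λ₀`) satisfies `4d ≤ Λ₀`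
(`four_d_le_of_wilsonHessianBound'`, Prop. D), so its window `{N/2 - N|β|Λ₀ > 0}` is contained in
`|β| < 1/(8d)`: no instance of the parameterised SZZ argument reaches beyond `1/(8d)`. -/
theorem transfer_window_subset_sharp (hd : 2 ≤ d) (hN : 2 ≤ N) {Λ₀ : ℝ}
    (hH : WilsonHessianBound d N Λ₀) {β : ℝ} (hK : 0 < (N : ℝ) / 2 - N * |β| * Λ₀) :
    |β| < sharpThresholdSU d := by
  have h4 : 4 * (d : ℝ) ≤ Λ₀ := four_d_le_of_wilsonHessianBound' hd hN hH
  have hK' : 0 < (N : ℝ) / 2 - N * |β| * (4 * d) := transferConst_pos_mono h4 hK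
  rw [← sharpBakryEmeryConstSU_eq] at hK'
  exact (sharpBakryEmeryConstSU_pos_iff (le_trans one_le_two hd) (le_trans one_le_two hN) β).1 hK'

/-- Numbers of record for this leg (`d = 4`): clustering of every tight limit for `|β| < 1/32`
(`SU(N)`, all `N ≥ 2`), i.e. `β_W = N²β < N²/32` (`SU(2)`: `1/8`; `SU(3)`: `9/32`), against the
printed `1/48` (`1/12`, `3/16`) — the arithmetic is `sharpThresholdSU_values` /
`sharpThresholdSU_wilson_values` of `SharpWindow`; restated here for the clustering leg. -/
theorem clusteringBelow_sharp_dim4 (h : shenZhuZhu_massGap_transfer 4 N) (hN : 2 ≤ N) :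
    ClusteringBelow 4 N (1 / 32) := by
  have := clusteringBelow_sharp h (by norm_num) hN
  rwa [sharpThresholdSU_values.1] at this

/-! ## What separates this leg from the cell's target type `MassGapAt`: DLR uniqueness, and only that -/

/-- **Uniqueness + clustering of tight limits ⇒ `MassGapAt`.** If the DLR state at tree coupling
`Nβ` is unique and every tight limit clusters (SZZ form), then `MassGapAt d N β` holds: the unique
DLR state IS a tight limit (limit points exist, `infiniteVolumeLimitPoints_nonempty_holds`, and are
DLR, `mem_ymGibbsMeasures_of_mem_infiniteVolumeLimitPoints_holds`). So, given the transfer fact,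
`MassGapAt` at `|β| < 1/(8d)` is EQUIVALENT to DLR uniqueness there (converse direction:
`MassGapAt` contains uniqueness by definition). -/
theorem massGapAt_of_hasUniqueGibbsMeasure {β : ℝ}
    (hu : Literature.Probability.LatticeModels.HasUniqueGibbsMeasure
      (ymSpecification (d := d) (fundamentalRep (Fin N)) ((N : ℝ) * β)))
    (hc : SZZExponentialClustering d N β) : MassGapAt d N β := by
  refine ⟨hu, fun μ hμ => ?_⟩
  haveI : SecondCountableTopology (Matrix (Fin N) (Fin N) ℂ) :=
    inferInstanceAs (SecondCountableTopology (Fin N → Fin N → ℂ))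
  haveI : SecondCountableTopology (Matrix.specialUnitaryGroup (Fin N) ℂ) :=
    Topology.IsEmbedding.subtypeVal.secondCountableTopology
  obtain ⟨ν, hν⟩ := infiniteVolumeLimitPoints_nonempty_holds (d := d) (fundamentalRep (Fin N))
    (continuous_fundamentalRep (Fin N)) ((N : ℝ) * β)
  have hνG : ν ∈ ymGibbsMeasures (d := d) (fundamentalRep (Fin N)) ((N : ℝ) * β) :=
    mem_ymGibbsMeasures_of_mem_infiniteVolumeLimitPoints_holds (fundamentalRep (Fin N))
      (continuous_fundamentalRep (Fin N)) hν
  have hμν : μ = ν := hu.1 hμ hνG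
  rw [hμν]
  exact hc ν hν

/-- **The cell's own uniqueness CLAIM at the sharp window, as a hypothesis shape** (NOT a
Literature fact and NOT proved in the tree: `p2/HESSIAN-SHARP.md` §4 / `paper` Lemma A.1, class A —
a weighted `W₂` synchronous-coupling contraction re-entering SZZ §5 with the global Hessian
constant): for every `|β| < 1/(8d)` the `SU(N)` Wilson specification at tree coupling `Nβ` has a
unique DLR state. -/
def SharpUniqueness (d N : ℕ) : Prop :=
  ∀ β : ℝ, |β| < sharpThresholdSU d →
    Literature.Probability.LatticeModels.HasUniqueGibbsMeasure
      (ymSpecification (d := d) (fundamentalRep (Fin N)) ((N : ℝ) * β))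

/-- **`MassGapBelow d N (1/(8d))` from the transfer fact and the uniqueness claim.** Conditional on
the named printed fact `shenZhuZhu_massGap_transfer` AND the cell's class-A uniqueness claim
`SharpUniqueness d N`, the cell's target statement holds at the sharp window. This isolates exactly
what is missing for a kernel `ImprovedThreshold`: DLR uniqueness on `1/(16(d-1)) ≤ |β| < 1/(8d)`. -/
theorem massGapBelow_sharp_of_uniqueness (h : shenZhuZhu_massGap_transfer d N)
    (hu : SharpUniqueness d N) (hd : 2 ≤ d) (hN : 2 ≤ N) :
    MassGapBelow d N (sharpThresholdSU d) :=
  fun β hβ => massGapAt_of_hasUniqueGibbsMeasure (hu β hβ) (sharp_exponentialClustering h hd hN hβ)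

/-- Hence, for `d ≥ 3`, the cell's target type `ImprovedThreshold d N (1/(8d))` — conditional on the
transfer fact and on `SharpUniqueness` (the printed bar `1/(16(d-1))` is `szzThresholdSU d` by
definition). -/
theorem improvedThreshold_sharp_of_uniqueness (h : shenZhuZhu_massGap_transfer d N)
    (hu : SharpUniqueness d N) (hd : 3 ≤ d) (hN : 2 ≤ N) :
    ImprovedThreshold d N (sharpThresholdSU d) :=
  ⟨szzThresholdSU_lt_sharpThresholdSU hd,
    massGapBelow_sharp_of_uniqueness h hu (le_trans (by norm_num) hd) hN⟩

end Summit.Ventures.YMGap.HessianSharp
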